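import Summits.QuantumFields.QCD.Theorems.MobilityGap.Negative.LowerPin
import Summits.QuantumFields.QCD.Theorems.WilsonMobilityGapMobilityGapSketchFreeReduction

/-!
# `MobilityGap` (stmt-QuantumFields-9150) after the statement re-type: transfer to and from the
pinned crux `ChiralMobilityGap` (stmt-QuantumFields-17497)

Since route revision 8 (2026-08-16, statement re-type p117723) the deciding theorem of route
`WilsonMobilityGap` consumes `ChiralMobilityGap` — the text of `MobilityGap` with the chiral pin
`reg.IsChiralAtZero ∧` inserted after `reg.HasMassScaling ∧` — and `MobilityGap` is kept verbatim as
the offset-free SUPPORT so that its dossier (skeletons, `Negative/LowerPin`, sibling reduction,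
necessity of the infrared core) stays attached.  This file is the kernel-checked bridge announced in
the route text ("`ChiralMobilityGap → MobilityGap` … one line"):

* `chiralMobilityGap_iff` — the pinned crux re-read through the VERBATIM clause package
  `MobilityGapNegative.Clauses` of the support: `ChiralMobilityGap ↔ ∀ N_f ∈ {2,3}, ∃ reg,
  reg.IsChiralAtZero ∧ Clauses N_f reg` (so every clause-level lemma banked on 9150 applies to 17497
  unchanged);
* `mobilityGap_of_chiralMobilityGap` — dropping the pin: a proof of 17497 closes 9150;
* `lawLightFree_of_chiralMobilityGap` — the open infrared core `LawLightFree`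
  (`∀ N_f ∈ {2,3}, LightMomentFree N_f`), kernel-checked NECESSARY for `MobilityGap`
  (`MobilityGapSketch.lawLightFree_of_mobilityGap`), is therefore necessary for the pinned crux too:
  every line for 17497 must contain a mechanism for it (see `Cruxes/MobilityGap/Lines/Sketch-dead.md`);
* `chiralMobilityGap_witness_window` — the disprover's bare-mass window transfers: any witness of the
  pinned crux has, for every positive mass tuple, all realised bare masses in `|m_f(k) + 4| < 41/10`
  eventually.

Pure logic over landed files; no analysis.
-/

namespace Summit.QuantumFields.QCD.Theorems.WilsonMobilityGap

open Filter
open Summit.QuantumFields.QCD.Theses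
open Summit.QuantumFields.QCD.Theorems.MobilityGapNegative (Clauses bare)
open Literature.MathematicalPhysics.QuantumFieldTheory

/-- **The pinned crux, clause by clause.** `ChiralMobilityGap` is, for `N_f = 2, 3`, the existence of
a regularisation that is chiral at zero AND carries the verbatim clause package `Clauses N_f reg` of
the support `MobilityGap` (both scalings and, for every positive mass tuple, clauses (i)–(iv)).
Definitional up to one commutation of conjuncts. -/
theorem chiralMobilityGap_iff :
    WilsonMobilityGap.ChiralMobilityGap ↔
      ∀ Nf : ℕ, Nf = 2 ∨ Nf = 3 →
        ∃ reg : QCDRegularisation Nf, reg.IsChiralAtZero ∧ Clauses Nf reg := by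
  refine forall₂_congr fun Nf _ => exists_congr fun reg => ?_
  exact and_left_comm

/-- **Dropping the pin.** The pinned crux `ChiralMobilityGap` (stmt-QuantumFields-17497) implies the
offset-free support `MobilityGap` (stmt-QuantumFields-9150): forget `reg.IsChiralAtZero`. -/
theorem mobilityGap_of_chiralMobilityGap : Summit.QuantumFields.QCD.Theses.WilsonMobilityGap.ChiralMobilityGap → Summit.QuantumFields.QCD.Theses.WilsonMobilityGap.MobilityGap := by
  intro h Nf hNf
  obtain ⟨reg, hMS, -, hAS, hm⟩ := h Nf hNf
  exact ⟨reg, hMS, hAS, hm⟩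

/-- **The infrared core is necessary for the pinned crux as well.** `ChiralMobilityGap → LawLightFree`:
along some asymptotically free sequence of couplings, at each large `k` some bare mass `> -1` has
infinite-volume phase-quenched typical quark-propagator decay rate `O(a_k)` — the open content located
by the crux chain of stmt-QuantumFields-9150 (`lawLightFree_of_mobilityGap`), inherited verbatim. -/
theorem lawLightFree_of_chiralMobilityGap (h : WilsonMobilityGap.ChiralMobilityGap) :
    MobilityGapSketch.LawLightFree :=
  MobilityGapSketch.lawLightFree_of_mobilityGap (mobilityGap_of_chiralMobilityGap h)

/-- **The bare-mass window transfers.** For any witness `reg` of the pinned clause package and any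
positive mass tuple `m`, clause (iii) alone forces every realised bare mass into
`|m_f(k) + 4| < 41/10` eventually (the disprover's `eventually_window_of_lower` for 9150, re-used). -/
theorem chiralMobilityGap_witness_window {Nf : ℕ} {reg : QCDRegularisation Nf}
    (h : reg.IsChiralAtZero ∧ Clauses Nf reg) (m : Fin Nf → ℝ) (hm : ∀ f, 0 < m f) (f : Fin Nf) :
    ∀ᶠ k in atTop, |bare reg m k f + 4| < 41 / 10 :=
  MobilityGapNegative.eventually_window_of_lower reg m (h.2.2.2 m hm).2.2.1 f

end Summit.QuantumFields.QCD.Theorems.WilsonMobilityGap
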